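import Summits.BirchSwinnertonDyer.BirchSwinnertonDyer.Theorems.CyclotomicUntwistFormalEtaResidue
import Literature.NumberTheory.EllipticCurves.DescendedFrobeniusMatrix
import Literature.NumberTheory.EllipticCurves.PadicSigmaVariableChangeProofs
import Literature.NumberTheory.EllipticCurves.ManinConstantSemistableTwistProofs
import HarnessLib

/-!
# Transport of Katz's Néron classes along the `𝓞`-integral change between two good models over `𝓞 = 𝓞_{ℚ₃(ζ₉)}`:
# `classOmega 𝓜₂ ∘ θ = classOmega 𝓜₁` exactly and `classEta 𝓜₂ ∘ θ = classEta 𝓜₁ + u₂·(𝓞-series)`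

Cell `pub/bsd-wall` (D-0145 line `route-BirchSwinnertonDyer-CyclotomicUntwist`), width seat `bsd-line-cycu-p4` (gen 8),
lane «MODEL TRANSPORT ALONG THE 𝓞-CHANGE» (part 1 of 2; part 2 = `CyclotomicUntwistDescendedFrobeniusOneModel`:
model independence of `IsPowerMapMatrix` / `ClassesIndependent` and the ONE-MODEL CRITERION for
`IsDescendedFrobeniusMatrix`). THEOREMS ONLY (no definition, no instance, no named fact, no `sorry`); helper `--supports`
K1 = stmt-BirchSwinnertonDyer-21580 `PSRankOneLowerHalfAtThree` (serves K2 = 21581 and the print child C2 = 27549, whose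
input is the Literature named fact `WeierstrassCurve.isDescendedFrobeniusMatrix_exists`, p623342). BSD is not proved by
this file and no crux / stub is.

## What

The Literature predicate `IsDescendedFrobeniusMatrix W M` quantifies its three clauses (`ClassesIndependent`, the two
`IsPowerMapMatrix`) over ALL good models `𝓜 : W.NineGoodModel` (an `𝓞`-integral equation `𝓜.E` with unit discriminant
and a change of variables `𝓜.C` over `K = ℚ₃(ζ₉)`), the clauses being congruences modulo bounded denominators between the
Néron representatives `classOmega 𝓜 = u⁻¹·log_𝓔`, `classEta 𝓜 = u·∫(x_𝓔ω_𝓔 − dz/z²) + ru⁻¹·log_𝓔` in `K⟦z⟧`, `z` the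
parameter of `𝓔 = 𝓜.E ⊗ K`. Two good models differ by a change of variables `D = (u_D; r_D, s_D, t_D)` OVER `𝓞`
(`NineIntegers.exists_variableChange_smul_eq`, cycu-p4 g7, Silverman VII.1.3(b) over the DVR `𝓞`): `D • 𝓜₁.E = 𝓜₂.E`,
`D ⊗ K = 𝓜₂.C·𝓜₁.C⁻¹`, and the tree's isomorphism of formal groups `θ = θ_D : Ê₁ ⥲ Ê₂`
(`formalVariableChange`, `θ = u_D z + ⋯ ∈ z𝓞⟦z⟧`) relates the parameters. This file proves, as identities in `K⟦z⟧`: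

* §1 `X_sq_mul_derivative_formalEtaIntegral` — `z²·(∫(xω − dz/z²))′ = (z²x)(ω/dz) − 1` (the representative of
  `[η]` is an honest integral: `P₀ = 1`, `P₁ = 0`, `FormalEtaResidue`);
* §2 **`exists_formalEtaIntegral_smul_subst_formalVariableChange`** — for `V/𝓞` and `D` over `𝓞`:
  `(∫η_{D•V}) ∘ θ = u_D⁻¹·∫η_V − u_D⁻¹r_D·log_V + g`, **`g ∈ 𝓞⟦z⟧`** (`x' = u⁻²(x − r)`, `ω'∘θ·θ' = u·ω` from
  `FormalGroupVariableChangeProofs`; the two pole parts `dz'/z'²`, `u⁻¹dz/z²` differ by the exact INTEGRAL form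
  `d(1/θ − u⁻¹/z)` since `θ/z` is a unit of `𝓞⟦z⟧` — `ManinConstantSemistableTwistProofs.exists_map_eq_formalVariableChange`);
  proof by `PowerSeries.derivative.ext` after clearing `z²θ²`;
* §3 for two good models: `smul_curve_eq`, `C_eq`, `u_eq` (`u₂ = u_D u₁`), `r_eq` (`r₂ = r_D u₁² + r₁`),
  **`classOmega_subst`** (`classOmega 𝓜₂ ∘ θ = classOmega 𝓜₁`, from `formalLog_variableChange_subst`) and
  **`exists_classEta_subst`** (`classEta 𝓜₂ ∘ θ = classEta 𝓜₁ + u₂·g`, `g ∈ 𝓞⟦z⟧`).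

This is the functoriality of Katz's `D(Ĝ/𝓞) ⊗ ℚ` in the isomorphism `θ` [Ka81, §5.1], made explicit on the two Néron
classes; part 2 turns it into the model independence of the Literature clauses.

References: N. M. Katz, *Crystalline cohomology, Dieudonné modules, and Jacobi sums* (1981) §5.1, Lemma 5.1.2,
Thm 5.1.4 [Katz1981CrystallineDieudonne]; J. H. Silverman, *AEC* III.1 (Table 3.1), IV.1, IV.5.5, VII.1.3
[SilvermanAEC2009]; P. Berthelot, A. Ogus, Invent. Math. 72 (1983) (3.14) [BerthelotOgus1983].
-/

set_option autoImplicit false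
-- single-conjunct summit: `Summit.BirchSwinnertonDyer.BirchSwinnertonDyer.…` repeats the name by design
set_option linter.dupNamespace false

noncomputable section

open scoped Classical
open PowerSeries WeierstrassCurve Literature.NumberTheory.EllipticCurves.DescendedFrobenius
  Summit.BirchSwinnertonDyer.BirchSwinnertonDyer.Theorems

namespace Summit.BirchSwinnertonDyer.BirchSwinnertonDyer.Theorems.NineGoodModelTransport

/-- Coefficients of the image of an `𝓞`-series are `ℤ₃`-integral. [folklore] -/
theorem isIntegral_coeff_map (G : ONine⟦X⟧) (n : ℕ) :
    IsIntegral ℤ_[3] (coeff n (G.map (algebraMap ONine KNine))) := by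
  rw [coeff_map]
  exact (coeff n G).2

/-! ### §1 `z²·d∫η = P − 1`: the derivative of the second-kind representative -/

/-- **`z² · (∫(xω − dz/z²))′ = (z²x)·(ω/dz) − 1`** over any `ℚ`-algebra (`P₀ = 1`, `P₁ = 0`: the pole and the
residue of `x·ω` are removed, `FormalEtaResidue`). [cite: Katz1981CrystallineDieudonne, §5 Lemma 5.1.2] -/
theorem X_sq_mul_derivative_formalEtaIntegral {A : Type*} [CommRing A] [Algebra ℚ A] (V : WeierstrassCurve A) :
    X ^ 2 * d⁄dX A V.formalEtaIntegral = V.formalXMulSq * V.formalOmega - 1 := by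
  ext n
  rw [coeff_X_pow_mul', map_sub, coeff_one]
  rcases n with _ | _ | m
  · simp [FormalEtaResidue.constantCoeff_formalXMulSq_mul_formalOmega]
  · simp [FormalEtaResidue.coeff_one_formalXMulSq_mul_formalOmega]
  · rw [if_pos (by omega), if_neg (by omega), sub_zero, show m + 2 - 2 = m by omega, coeff_derivative,
      V.coeff_succ_formalEtaIntegral m, mul_comm, ← mul_assoc,
      show ((m : A) + 1) * algebraMap ℚ A (1 / (m + 1 : ℚ)) = 1 by
        rw [show ((m : A) + 1) = algebraMap ℚ A (m + 1 : ℚ) by rw [map_add, map_natCast, map_one],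
          ← map_mul, mul_one_div_cancel (by positivity), map_one], one_mul]

/-! ### §2 The second-kind representative under an `𝓞`-integral change of variables -/

section EtaCore

/-- **`∫η` under an integral change of variables.** Let `V/𝓞` be a Weierstrass equation, `D = (u; r, s, t)` a change
of variables OVER `𝓞` (`u ∈ 𝓞ˣ`), `𝓥 = V ⊗ K`, `𝓥' = D • 𝓥`, and `θ = u(z − rw)/(1 + sz + (t − sr)w) ∈ z𝓞⟦z⟧` the induced
isomorphism of formal groups (`formalVariableChange`). Then
`(∫η_{𝓥'}) ∘ θ = u⁻¹·∫η_𝓥 − u⁻¹r·log_𝓥 + g` with `g ∈ 𝓞⟦z⟧`: from `x' = u⁻²(x − r)`, `ω'∘θ·θ' = u·ω`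
(`η' = x'ω'` pulls back to `u⁻¹η − u⁻¹r·ω`) and `d(1/θ − u⁻¹/z) ∈ 𝓞⟦z⟧dz` (the pole parts `dz'/z'²`, `u⁻¹dz/z²` differ by
an INTEGRAL exact form because `θ = uz·(unit of 𝓞⟦z⟧)`). [cite: Katz1981CrystallineDieudonne, §5.1 (p. 193)]
[cite: SilvermanAEC2009, III.1 Table 3.1 and IV.1] -/
theorem exists_formalEtaIntegral_smul_subst_formalVariableChange (V : WeierstrassCurve ONine)
    (D : VariableChange ONine) :
    ∃ g : ONine⟦X⟧,
      ((D.baseChange KNine) • V.map (algebraMap ONine KNine)).formalEtaIntegral.subst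
          ((V.map (algebraMap ONine KNine)).formalVariableChange (D.baseChange KNine)) =
        PowerSeries.C (((D.baseChange KNine).u⁻¹ : KNineˣ) : KNine) *
            (V.map (algebraMap ONine KNine)).formalEtaIntegral -
          PowerSeries.C ((((D.baseChange KNine).u⁻¹ : KNineˣ) : KNine) * (D.baseChange KNine).r) *
            (V.map (algebraMap ONine KNine)).formalLog +
          g.map (algebraMap ONine KNine) := by
  set ι := algebraMap ONine KNine with hι
  set DK := D.baseChange KNine with hDK
  set VK := V.map ι with hVK
  set θ := VK.formalVariableChange DK with hθdef
  have hθs : HasSubst θ := VK.hasSubst_formalVariableChange DK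
  have hθ0 : constantCoeff θ = 0 := VK.constantCoeff_formalVariableChange DK
  -- the integral avatar `θ₀` of `θ`
  obtain ⟨θ₀, hθ₀, hθ₀0, hθ₀1⟩ := exists_map_eq_formalVariableChange V DK D.u D.r D.s D.t
    (by simp [hDK, VariableChange.baseChange]) (by simp [hDK, VariableChange.baseChange])
    (by simp [hDK, VariableChange.baseChange]) (by simp [hDK, VariableChange.baseChange])
  replace hθ₀ : θ₀.map ι = θ := by rw [hθdef, hVK, hι]; exact hθ₀
  -- `θ₀ = X·T₀`, `T₀(0) = u`, `T₀·Ti₀ = 1`, `Ti₀ = X·G₀ + u⁻¹`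
  set T₀ : ONine⟦X⟧ := PowerSeries.mk fun n => coeff (n + 1) θ₀ with hT₀
  have hθT₀ : θ₀ = X * T₀ := by
    have h := eq_X_mul_shift_add_const θ₀
    rwa [hθ₀0, map_zero, add_zero] at h
  have hT₀0 : constantCoeff T₀ = D.u := by
    rw [← coeff_zero_eq_constantCoeff, hT₀, coeff_mk, zero_add, hθ₀1]
  set Ti₀ : ONine⟦X⟧ := invOfUnit T₀ D.u with hTi₀
  have hTT₀ : T₀ * Ti₀ = 1 := mul_invOfUnit T₀ D.u hT₀0
  set G₀ : ONine⟦X⟧ := PowerSeries.mk fun n => coeff (n + 1) Ti₀ with hG₀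
  have hTi₀ : Ti₀ = X * G₀ + PowerSeries.C ((D.u⁻¹ : ONineˣ) : ONine) := by
    have h := eq_X_mul_shift_add_const Ti₀
    rwa [hTi₀, constantCoeff_invOfUnit, ← hTi₀] at h
  -- read over `K`
  set T := T₀.map ι with hT
  set Ti := Ti₀.map ι with hTidef
  set G := G₀.map ι with hG
  have hθT : θ = X * T := by rw [← hθ₀, hθT₀, map_mul, map_X]
  have hTT : T * Ti = 1 := by rw [hT, hTidef, ← map_mul, hTT₀, map_one]
  have huinv : ((DK.u⁻¹ : KNineˣ) : KNine) = ι ((D.u⁻¹ : ONineˣ) : ONine) := by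
    simp [hDK, VariableChange.baseChange, hι]
  have hTi : Ti = X * G + PowerSeries.C ((DK.u⁻¹ : KNineˣ) : KNine) := by
    rw [hTidef, hTi₀, map_add, map_mul, map_X, map_C, huinv]
  have huu : PowerSeries.C ((DK.u⁻¹ : KNineˣ) : KNine) * PowerSeries.C (DK.u : KNine) = (1 : KNine⟦X⟧) := by
    rw [← map_mul, Units.inv_mul, map_one]
  -- derivatives of the structure relations
  have hdθ : d⁄dX KNine θ = T + X * d⁄dX KNine T := by
    rw [hθT, Derivation.leibniz, derivative_X, smul_eq_mul, smul_eq_mul, mul_one]; ring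
  have hdTT : d⁄dX KNine T * Ti + T * d⁄dX KNine Ti = 0 := by
    have h := congrArg (d⁄dX KNine) hTT
    rw [Derivation.leibniz, smul_eq_mul, smul_eq_mul, Derivation.map_one_eq_zero] at h
    linear_combination h
  have hdTi : d⁄dX KNine Ti = G + X * d⁄dX KNine G := by
    rw [hTi, map_add, derivative_C, add_zero, Derivation.leibniz, derivative_X, smul_eq_mul, smul_eq_mul,
      mul_one]; ring
  -- the formal-group identities under `θ`
  have h1 := VK.formalXMulSq_variableChange_subst_mul_X_sq DK
  have h2 := VK.formalOmega_variableChange_subst_mul_derivative DK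
  have hP1 := X_sq_mul_derivative_formalEtaIntegral VK
  have hP2 := X_sq_mul_derivative_formalEtaIntegral (DK • VK)
  have hCθ : ∀ a : KNine, (PowerSeries.C a).subst θ = PowerSeries.C a := fun a => PowerSeries.subst_C a
  have hA : θ ^ 2 * (d⁄dX KNine (DK • VK).formalEtaIntegral).subst θ =
      (DK • VK).formalXMulSq.subst θ * (DK • VK).formalOmega.subst θ - 1 := by
    have h := congrArg (PowerSeries.subst θ) hP2
    simp only [← coe_substAlgHom hθs, map_mul, map_sub, map_pow, map_one, substAlgHom_X] at h
    simpa only [coe_substAlgHom hθs] using h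
  -- assemble: compare derivatives after multiplying by `X²θ²`
  refine ⟨G₀ - PowerSeries.C (constantCoeff G₀), ?_⟩
  rw [map_sub, map_C, ← hG]
  set A := (d⁄dX KNine (DK • VK).formalEtaIntegral).subst θ with hAdef
  set B := (DK • VK).formalXMulSq.subst θ with hBdef
  set Ω' := (DK • VK).formalOmega.subst θ with hΩ'def
  set Cui : KNine⟦X⟧ := PowerSeries.C ((DK.u⁻¹ : KNineˣ) : KNine) with hCui
  set Cu : KNine⟦X⟧ := PowerSeries.C (DK.u : KNine) with hCu
  set Cr : KNine⟦X⟧ := PowerSeries.C DK.r with hCr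
  set Q₁ := VK.formalXMulSq with hQ₁
  set Ω₁ := VK.formalOmega with hΩ₁
  set η₁' := d⁄dX KNine VK.formalEtaIntegral with hη₁'
  set dθ := d⁄dX KNine θ with hdθdef
  set dT := d⁄dX KNine T with hdTdef
  set dTi := d⁄dX KNine Ti with hdTidef
  set dG := d⁄dX KNine G with hdGdef
  have s1 : X ^ 2 * θ ^ 2 * (A * dθ) = Cui * θ ^ 2 * (Q₁ - Cr * X ^ 2) * Ω₁ - X ^ 2 * dθ := by
    linear_combination (X ^ 2 * dθ) * hA + (Ω' * dθ) * h1 + (Cui ^ 2 * θ ^ 2 * (Q₁ - Cr * X ^ 2)) * h2 +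
      (Cui * θ ^ 2 * (Q₁ - Cr * X ^ 2) * Ω₁) * huu
  have s3 : X ^ 2 * T ^ 2 * dG = -(X * dT) - T + Cui * T ^ 2 := by
    linear_combination (X * T) * hdTT + (-(X * dT) - T) * hTT - (X * T ^ 2) * hdTi + T ^ 2 * hTi
  apply PowerSeries.derivative.ext
  · -- equal derivatives: cancel `X²θ²`
    have hX : (X : KNine⟦X⟧) ^ 2 * θ ^ 2 ≠ 0 := by
      refine mul_ne_zero (pow_ne_zero _ X_ne_zero) (pow_ne_zero _ fun h => ?_)
      have := congrArg (coeff 1) h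
      rw [VK.coeff_one_formalVariableChange DK, map_zero] at this
      exact DK.u.ne_zero this
    apply mul_left_cancel₀ hX
    rw [PowerSeries.derivative_subst KNine hθs, map_add, map_sub, Derivation.leibniz, Derivation.leibniz,
      derivative_C, derivative_C, smul_zero, add_zero, smul_zero, add_zero, smul_eq_mul, smul_eq_mul,
      VK.derivative_formalLog, map_sub, derivative_C, sub_zero]
    have s2 : X ^ 2 * θ ^ 2 * (Cui * η₁' - PowerSeries.C ((((DK.u⁻¹ : KNineˣ) : KNine)) * DK.r) * Ω₁ + dG) =
        Cui * θ ^ 2 * (Q₁ * Ω₁ - 1) - Cui * Cr * X ^ 2 * θ ^ 2 * Ω₁ + X ^ 2 * θ ^ 2 * dG := by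
      rw [map_mul, ← hCui, ← hCr]
      linear_combination (Cui * θ ^ 2) * hP1
    rw [← hAdef, ← hdθdef, ← hη₁', ← hdGdef]
    linear_combination s1 - s2 + ((Cui - X ^ 2 * dG) * (θ + X * T)) * hθT - X ^ 2 * hdθ - X ^ 2 * s3
  · -- both vanish at `0`
    have hG0 : constantCoeff G = ι (constantCoeff G₀) := by
      rw [hG, ← coeff_zero_eq_constantCoeff_apply, coeff_map, coeff_zero_eq_constantCoeff_apply]
    rw [map_add, map_sub, map_sub, map_mul, map_mul, constantCoeff_C, constantCoeff_C, constantCoeff_C,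
      VK.constantCoeff_formalLog, WeierstrassCurve.constantCoeff_formalEtaIntegral, mul_zero, mul_zero, sub_zero,
      zero_add, hG0, sub_self]
    exact MvPowerSeries.constantCoeff_subst_eq_zero (PowerSeries.HasSubst.const hθs) (fun _ => hθ0)
      (DK • VK).constantCoeff_formalEtaIntegral

end EtaCore

/-- The integral avatar of `θ`: for `V/𝓞` and `D` over `𝓞`, `θ = θ₀ ⊗ K` with `θ₀ ∈ z𝓞⟦z⟧`
(`ManinConstantSemistableTwistProofs.exists_map_eq_formalVariableChange`). [cite: SilvermanAEC2009, IV.1] -/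
theorem exists_map_eq_formalVariableChange_baseChange (V : WeierstrassCurve ONine) (D : VariableChange ONine) :
    ∃ θ₀ : ONine⟦X⟧, θ₀.map (algebraMap ONine KNine) =
      (V.map (algebraMap ONine KNine)).formalVariableChange (D.baseChange KNine) ∧ constantCoeff θ₀ = 0 := by
  obtain ⟨θ₀, hθ₀, hθ₀0, -⟩ := exists_map_eq_formalVariableChange V (D.baseChange KNine) D.u D.r D.s D.t
    (by simp [VariableChange.baseChange]) (by simp [VariableChange.baseChange])
    (by simp [VariableChange.baseChange]) (by simp [VariableChange.baseChange])
  exact ⟨θ₀, hθ₀, hθ₀0⟩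

/-! ### §3 Two good models of one curve: the Néron classes correspond under `θ` -/

section Models

variable {W : WeierstrassCurve ℚ} {𝓜₁ 𝓜₂ : W.NineGoodModel} {D : VariableChange ONine}

/-- `D ⊗ K` carries the first model (read in `K`) to the second. [cite: SilvermanAEC2009, VII.1.3] -/
theorem smul_curve_eq (hD : D • 𝓜₁.E = 𝓜₂.E) : (D.baseChange KNine) • 𝓜₁.curve = 𝓜₂.curve := by
  rw [NineGoodModel.curve, NineGoodModel.curve, ← hD, VariableChange.baseChange, map_variableChange]

/-- The changes of variables compose: `C₂ = (D ⊗ K)·C₁`. [cite: SilvermanAEC2009, III.1] -/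
theorem C_eq (hDK : D.baseChange KNine = 𝓜₂.C * 𝓜₁.C⁻¹) : 𝓜₂.C = D.baseChange KNine * 𝓜₁.C := by
  rw [hDK, inv_mul_cancel_right]

/-- `u₂ = u_D·u₁`. [cite: SilvermanAEC2009, III.1] -/
theorem u_eq (hDK : D.baseChange KNine = 𝓜₂.C * 𝓜₁.C⁻¹) : 𝓜₂.C.u = (D.baseChange KNine).u * 𝓜₁.C.u := by
  rw [C_eq hDK]; rfl

/-- `r₂ = r_D·u₁² + r₁`. [cite: SilvermanAEC2009, III.1] -/
theorem r_eq (hDK : D.baseChange KNine = 𝓜₂.C * 𝓜₁.C⁻¹) :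
    𝓜₂.C.r = (D.baseChange KNine).r * (𝓜₁.C.u : KNine) ^ 2 + 𝓜₁.C.r := by
  rw [C_eq hDK]; rfl

/-- **`[ω_W]` is the SAME series on both models, read through `θ`: `classOmega 𝓜₂ ∘ θ = classOmega 𝓜₁`**
(`log₂ ∘ θ = u_D·log₁` and `u₂ = u_D u₁`). [cite: Katz1981CrystallineDieudonne, §5.1 (functoriality of D(G/R))]
[cite: SilvermanAEC2009, IV.5.5] -/
theorem classOmega_subst (hD : D • 𝓜₁.E = 𝓜₂.E) (hDK : D.baseChange KNine = 𝓜₂.C * 𝓜₁.C⁻¹) :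
    𝓜₂.classOmega.subst (𝓜₁.curve.formalVariableChange (D.baseChange KNine)) = 𝓜₁.classOmega := by
  have hθs := 𝓜₁.curve.hasSubst_formalVariableChange (D.baseChange KNine)
  rw [NineGoodModel.classOmega, NineGoodModel.classOmega, subst_smul hθs, ← smul_curve_eq hD,
    formalLog_variableChange_subst, smul_eq_C_mul, smul_eq_C_mul, ← mul_assoc, ← map_mul, u_eq hDK, mul_inv_rev,
    Units.val_mul, mul_assoc, Units.inv_mul, mul_one]

/-- **`[η_W]` corresponds under `θ` up to an INTEGRAL series**: `classEta 𝓜₂ ∘ θ = classEta 𝓜₁ + u₂·g`, `g ∈ 𝓞⟦z⟧`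
(§5 with `u₂ = u_D u₁`, `r₂ = r_D u₁² + r₁`). [cite: Katz1981CrystallineDieudonne, §5.1 (functoriality of D(G/R))]
[cite: SilvermanAEC2009, III.1 Table 3.1] -/
theorem exists_classEta_subst (hD : D • 𝓜₁.E = 𝓜₂.E) (hDK : D.baseChange KNine = 𝓜₂.C * 𝓜₁.C⁻¹) :
    ∃ g : ONine⟦X⟧, 𝓜₂.classEta.subst (𝓜₁.curve.formalVariableChange (D.baseChange KNine)) =
      𝓜₁.classEta + PowerSeries.C (𝓜₂.C.u : KNine) * g.map (algebraMap ONine KNine) := by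
  have hθs := 𝓜₁.curve.hasSubst_formalVariableChange (D.baseChange KNine)
  obtain ⟨g, hg⟩ := exists_formalEtaIntegral_smul_subst_formalVariableChange 𝓜₁.E D
  refine ⟨g, ?_⟩
  have hcurve : 𝓜₁.curve = 𝓜₁.E.map (algebraMap ONine KNine) := rfl
  rw [NineGoodModel.classEta, NineGoodModel.classEta, subst_add hθs, subst_smul hθs, subst_smul hθs,
    ← smul_curve_eq hD, formalLog_variableChange_subst, hcurve, hg, u_eq hDK, r_eq hDK]
  simp only [smul_eq_C_mul, map_mul, map_add, map_pow, mul_inv_rev, Units.val_mul]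
  have ha : PowerSeries.C (𝓜₁.C.u : KNine) * PowerSeries.C ((𝓜₁.C.u⁻¹ : KNineˣ) : KNine) = (1 : KNine⟦X⟧) := by
    rw [← map_mul, Units.mul_inv, map_one]
  have hb : PowerSeries.C ((D.baseChange KNine).u : KNine) *
      PowerSeries.C (((D.baseChange KNine).u⁻¹ : KNineˣ) : KNine) = (1 : KNine⟦X⟧) := by
    rw [← map_mul, Units.mul_inv, map_one]
  set a : KNine⟦X⟧ := PowerSeries.C (𝓜₁.C.u : KNine)
  set ai : KNine⟦X⟧ := PowerSeries.C ((𝓜₁.C.u⁻¹ : KNineˣ) : KNine)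
  set b : KNine⟦X⟧ := PowerSeries.C ((D.baseChange KNine).u : KNine)
  set bi : KNine⟦X⟧ := PowerSeries.C (((D.baseChange KNine).u⁻¹ : KNineˣ) : KNine)
  set r : KNine⟦X⟧ := PowerSeries.C (D.baseChange KNine).r
  set r₁ : KNine⟦X⟧ := PowerSeries.C 𝓜₁.C.r
  set L := (𝓜₁.E.map (algebraMap ONine KNine)).formalLog
  set I := (𝓜₁.E.map (algebraMap ONine KNine)).formalEtaIntegral
  linear_combination (a * I + r₁ * ai * L) * hb + (b * bi * r * a * L) * ha

end Models

end Summit.BirchSwinnertonDyer.BirchSwinnertonDyer.Theorems.NineGoodModelTransport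

end
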